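import Summits.QuantumFields.YangMills.Theorems.UnitScaleTiltProp7SectET3ActionQuadT3
import Mathlib.Analysis.Complex.CauchyIntegral
import HarnessLib

/-!
# Route `UnitScaleTilt`, crux «MinimiserStabilityRegPr» (stmt-QuantumFields-19200, stub EX), node N06(d = 3), route (α) — LAYER 0, ROWS (def-free), «Δ310-EXPLICIT» PART (B):
# **BRICK L0b's ABSTRACT HESSIAN FORM IS PRINT'S (3.10) AT THE MEMBER — `hessFormRe U₀ Z Z = −Σ_p [τ((D¹_{U₀}Z)(p)²·Re U₀(∂p)) + τ(i·Σ_{b₁≺b₂}[Z′(b₁),Z′(b₂)]·Im U₀(∂p))]`**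
# (`τ = ½tr`, EXACT background): the second Fréchet derivative `D²(actionRe ∘ chartU U₀)(0)[Z, Z]` (brick L0b's DEFINITION of the Wilson Hessian letter, ✓`hessFormRe`) equals TWICE
# the `z²`-coefficient of part (A)'s expansion ✓`Prop7SectET3ActionQuad.actionRe_chartU_smul_eq`, by ✓`iteratedDeriv_two_actionRe_line` and Taylor-coefficient uniqueness for the
# entire function `z ↦ actionRe (chartU U₀ (z•Z))` (power series of an entire function vs an `O(z³)` expansion)

Cell `ym3-torus`, width seat `ym3-torus-px5` (gen 0; FILL-TO-CAP «width 5»); EX-knit namer ★ym-ust-19200-w2 g5 GO (G6) 2026-08-28 16:51:55Z «px5: Δ310-EXPLICIT YES»; LOCATE memo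
`HOME/ym3-torus-px5/LOCATE-DELTA310-EXPLICIT-px5.md` §3 (B).  THEOREMS ONLY (0 `def`, 0 `sorry`); `--supports stmt-QuantumFields-19200 --as helper`; count-neutral.  YM₃ on T³ is
ladder rung R3, NOT the Clay problem; nothing here is a claim about a stub, a crux, d = 4 or the mass gap; nothing of [Balaban1985BackgroundPropagators] is asserted.

THE PRINT.  [Balaban1985BackgroundPropagators] p. 392: *«The quadratic terms in the expansion (3.7) define the basic operator … We denote it by Δ^η(U), or simply by Δ. … it is a hermitian
operator given by the quadratic form ⟨A, ΔA⟩ = ⟨A, D*DA⟩ + ⟨A, Δ′A⟩ … (3.10) … A^η(exp iηA U) = A^η(U) + ⟨A, J⟩ + ½⟨A, ΔA⟩ + ⋯. (3.12)»*.  Brick L0b (✓`Prop7SectET3WilsonHessianT3` §3)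
DEFINES `hessFormRe U₀ := D²(actionRe ∘ chartU U₀)(0)` abstractly; ✓`…CetaRows.iteratedDeriv_two_actionRe_line : ∂²_z actionRe (chartU U₀ (z•Z))|₀ = hessFormRe U₀ Z Z`; part (A) gives
`actionRe (chartU U₀ (z•Z)) = actionRe (bgUnits U₀) + z·𝔩 + z²·𝔮 + Σ_p rem3_p(z)` with `𝔮 = −½Σ_p[τ(C_p²·Re W_p) + τ((i•K_p)·Im W_p)]` and `‖rem3_p(z)‖ ≤ ρ_p‖z‖³` (`‖z‖ ≤ 1`).

WHAT IS PROVED (ns `…Theorems.Prop7SectET3HessFormExplicit`).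
* §1 TWO CALCULUS LEMMAS over `ℂ` (no lattice): ★`quadratic_coeff_eq_zero_of_isBigO` — a polynomial `α + zβ + z²γ` which is `O(‖z‖³)` at `0` vanishes identically (via `HasDerivAt.unique` twice);
  ★★`iteratedDeriv_two_eq_of_isBigO_cube` — for a `ℂ`-differentiable `g : ℂ → ℂ` with `g z − (a + zb + z²c) = O(‖z‖³)` at `0`: `iteratedDeriv 2 g 0 = 2c` (power series of the entire function,
  Mathlib `Differentiable.analyticAt`, `HasFPowerSeriesAt.isBigO_sub_partialSum_pow`, `HasFPowerSeriesOnBall.factorial_smul`).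
* §2 ★`actionRe_chartU_isBigO` — part (A)'s remainder IS `O(‖z‖³)` at `0` (✓`norm_rem3_chartU_le` summed over the member's plaquettes).
* §3 ★★★`hessFormRe_self_eq` — THE ROW: `hessFormRe F K U₀ Z Z = −Σ_{p : Plaq} [τ(C_p·C_p·reC W_p) + τ((I•K_p)·imC W_p)]` (`C_p = curl T U (formComp Z) p.μ p.ν p.src`, `K_p = commSum (lettersA …)`,
  `W_p = plaqU T U p.μ p.ν p.src`, `T = torusT`, `U = fun μ x ↦ bgUnits F K U₀ ⟨x,μ⟩`) — print's `−⟨Z, ΔZ⟩` of (3.10) in the exponent direction `Z = iA` (`⟨A, D*DA⟩ + ⟨A, Δ′A⟩` with the `(iA)² = −A²`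
  sign), EXACT background.
* §4 `sum_plaq_eq_sum_posPlaq` (the member's `Plaq` sum IS lit's `posPlaq` sum) and ★★★`hessFormRe_self_eq_neg_hessPair` — THE JUNCTION-READY FORM
  `hessFormRe F K U₀ Z Z = −B9Eq39Adjoint.hessPair T U 1 3 τ (formComp Z)` (lit's `⟨A, ΔA⟩ = ⟨A, D*D_UA⟩ + ⟨A, Δ′A⟩` at unit spacing; through ✓`B9Eq310DeltaPrimeJunction.hessForm_self_eq_hessPair`
  this is `B9Eq310DeltaPrime.hessForm`'s diagonal, whose Riesz operator is ✓`B9Eq310HessianOperator.hessOp`).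
* §5 ★★`hessFormRe_eq_polar_hessPair` — the BILINEAR letter by polarization: `hessFormRe U₀ X′ X = −½(h(X′+X) − h(X′) − h(X))`, `h := hessPair T U 1 3 τ ∘ formComp`.
HONEST SCOPE.  Calculus bookkeeping over part (A) and lit's landed algebra; the OPERATOR identity (`DeltaEta` vs `hessOp`∕`η⁻²•D¹*D¹ + Δ′` on the carrier — mind the pairing weight `c₀`
and the trace normalisation, memo §3 (C)) and the `RegPr` bound of `Δ′` (memo (D), lit ✓`B9Eq369CurvOpSupLetter`) are NOT here.  No positivity, nothing of [B9] §3; nothing continuum ∕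
OS ∕ mass-gap ∕ Clay.

References: T. Bałaban, CMP **99** (1985) 389–434 [Balaban1985BackgroundPropagators] ((3.7) p.391, (3.10)–(3.12) p.392); CMP **102** (1985) 277–309 [Balaban1985Variational] ((19) p.281,
(135)–(140) pp.298–299).
-/

set_option autoImplicit false

noncomputable section

open scoped Matrix.Norms.L2Operator BigOperators Topology
open Complex (I)
open Asymptotics Filter

namespace Summit.QuantumFields.YangMills.Theorems.Prop7SectET3HessFormExplicit

open Literature.MathematicalPhysics.QuantumFieldTheory.Balaban1983to89
open Literature.MathematicalPhysics.QuantumFieldTheory.Balaban1983to89.T3ContinuumYM3Torus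
open T3SectALandauChart (formComp bgUnits)
open B9TorusCalculus (torusT)
open B9Eq37Insertion (reC imC)
open B9Eq39Adjoint (curl lettersA plaqU rem3)
open Beta.TransportVertices (commSum size)
open Summit.QuantumFields.YangMills.Theorems.Prop7SectET3WilsonHessian (chartU actionRe hessFormRe hessFormRe_symm iteratedDeriv_two_actionRe_line contDiff_actionRe_line)
open Summit.QuantumFields.YangMills.Theorems.Prop7SectET3ActionQuad (actionRe_chartU_smul_eq norm_rem3_chartU_le)

/-! ## §1 Two calculus lemmas over `ℂ` -/

/-- ★ **A QUADRATIC POLYNOMIAL THAT IS `O(‖z‖³)` AT `0` VANISHES**: `α = β = γ = 0`. (Evaluate at `0`; then the derivative at `0` of `z ↦ α + zβ + z²γ` is both `β` and `0`; then the same for `z ↦ zγ`.)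
[folklore] -/
theorem quadratic_coeff_eq_zero_of_isBigO {α β γ : ℂ}
    (h : (fun z : ℂ => α + z * β + z ^ 2 * γ) =O[𝓝 (0 : ℂ)] (fun z : ℂ => ‖z‖ ^ 3)) : α = 0 ∧ β = 0 ∧ γ = 0 := by
  obtain ⟨C, hC0, hC⟩ := h.exists_nonneg
  have hb : ∀ᶠ z : ℂ in 𝓝 0, ‖α + z * β + z ^ 2 * γ‖ ≤ C * ‖‖z‖ ^ 3‖ := hC.bound
  -- `α = 0`: evaluate at `z = 0`
  have hα : α = 0 := by
    have h0 := hb.self_of_nhds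
    simp only [zero_mul, add_zero, norm_zero, ne_eq, OfNat.ofNat_ne_zero, not_false_eq_true, zero_pow, mul_zero,
      norm_le_zero_iff] at h0
    exact h0
  subst hα
  -- the cubic majorant is `o(z)`
  have hcube : (fun z : ℂ => ‖z‖ ^ 3) =o[𝓝 (0 : ℂ)] (fun z : ℂ => z) := by
    have h1 : (fun z : ℂ => ‖z‖ ^ 3) =O[𝓝 (0 : ℂ)] (fun z : ℂ => z ^ 3) :=
      IsBigO.of_bound 1 (Eventually.of_forall fun z => by simp [norm_pow])
    have h2 : (fun z : ℂ => z ^ 3) =o[𝓝 (0 : ℂ)] (fun z : ℂ => z ^ 1) := isLittleO_pow_pow (by norm_num)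
    simpa using h1.trans_isLittleO h2
  -- `β = 0`: two derivatives of `P z = zβ + z²γ` at `0`
  have hPβ : HasDerivAt (fun z : ℂ => 0 + z * β + z ^ 2 * γ) β 0 := by
    have h1 : HasDerivAt (fun z : ℂ => z * β) β 0 := by simpa using hasDerivAt_mul_const β (x := (0 : ℂ))
    have h2 : HasDerivAt (fun z : ℂ => z ^ 2 * γ) 0 0 := by
      have := ((hasDerivAt_id' (0 : ℂ)).pow 2).mul_const γ
      simpa using this
    simpa using (h1.add h2).const_add 0
  have hP0 : HasDerivAt (fun z : ℂ => 0 + z * β + z ^ 2 * γ) 0 0 := by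
    rw [hasDerivAt_iff_isLittleO_nhds_zero]
    have : (fun h' : ℂ => 0 + (0 + h') * β + (0 + h') ^ 2 * γ - (0 + 0 * β + 0 ^ 2 * γ) - h' • (0 : ℂ))
        = fun z : ℂ => 0 + z * β + z ^ 2 * γ := by
      funext z; simp
    rw [this]
    exact h.trans_isLittleO hcube
  have hβ : β = 0 := hPβ.unique hP0
  subst hβ
  refine ⟨rfl, rfl, ?_⟩
  -- `γ = 0`: `zγ = O(‖z‖²) = o(z)` from `z²γ = O(‖z‖³)`
  have hQ : (fun z : ℂ => z * γ) =O[𝓝 (0 : ℂ)] (fun z : ℂ => ‖z‖ ^ 2) := by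
    refine IsBigO.of_bound C (hb.mono fun z hz => ?_)
    simp only [mul_zero, zero_add, add_zero] at hz
    rw [Real.norm_of_nonneg (by positivity)] at hz ⊢
    by_cases hz0 : z = 0
    · subst hz0; simp
    · have hzpos : 0 < ‖z‖ := norm_pos_iff.mpr hz0
      rw [norm_mul] at hz ⊢
      rw [norm_pow] at hz
      -- `‖z‖²‖γ‖ ≤ C‖z‖³` ⇒ `‖z‖‖γ‖ ≤ C‖z‖²`
      have : ‖z‖ * (‖z‖ * ‖γ‖) ≤ ‖z‖ * (C * ‖z‖ ^ 2) := by nlinarith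
      exact le_of_mul_le_mul_left this hzpos
  have hsq : (fun z : ℂ => ‖z‖ ^ 2) =o[𝓝 (0 : ℂ)] (fun z : ℂ => z) := by
    have h1 : (fun z : ℂ => ‖z‖ ^ 2) =O[𝓝 (0 : ℂ)] (fun z : ℂ => z ^ 2) :=
      IsBigO.of_bound 1 (Eventually.of_forall fun z => by simp [norm_pow])
    have h2 : (fun z : ℂ => z ^ 2) =o[𝓝 (0 : ℂ)] (fun z : ℂ => z ^ 1) := isLittleO_pow_pow (by norm_num)
    simpa using h1.trans_isLittleO h2
  have hQγ : HasDerivAt (fun z : ℂ => z * γ) γ 0 := by simpa using hasDerivAt_mul_const γ (x := (0 : ℂ))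
  have hQ0 : HasDerivAt (fun z : ℂ => z * γ) 0 0 := by
    rw [hasDerivAt_iff_isLittleO_nhds_zero]
    have : (fun h' : ℂ => (0 + h') * γ - 0 * γ - h' • (0 : ℂ)) = fun z : ℂ => z * γ := by
      funext z; simp
    rw [this]
    exact hQ.trans_isLittleO hsq
  exact hQγ.unique hQ0

/-- ★★ **TAYLOR-COEFFICIENT UNIQUENESS, SECOND ORDER, FOR AN ENTIRE FUNCTION**: if `g : ℂ → ℂ` is `ℂ`-differentiable and `g z − (a + zb + z²c) = O(‖z‖³)` at `0`, then
`iteratedDeriv 2 g 0 = 2c` (the power series of `g` at `0` — Mathlib `Differentiable.analyticAt` — has the same `O(‖z‖³)` property, so its first three coefficients are `a, b, c`;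
`2!·coeff₂ = ∂²g(0)` by `HasFPowerSeriesOnBall.factorial_smul`). [folklore] -/
theorem iteratedDeriv_two_eq_of_isBigO_cube {g : ℂ → ℂ} (hg : Differentiable ℂ g) {a b c : ℂ}
    (h : (fun z : ℂ => g z - (a + z * b + z ^ 2 * c)) =O[𝓝 (0 : ℂ)] (fun z : ℂ => ‖z‖ ^ 3)) :
    iteratedDeriv 2 g 0 = 2 * c := by
  obtain ⟨p, hp⟩ := hg.analyticAt 0
  obtain ⟨r, hpr⟩ := hp
  have hps := hpr.hasFPowerSeriesAt.isBigO_sub_partialSum_pow 3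
  -- the partial sum of order 3 is `coeff₀ + z·coeff₁ + z²·coeff₂`
  have hpart : ∀ z : ℂ, p.partialSum 3 z = p.coeff 0 + z * p.coeff 1 + z ^ 2 * p.coeff 2 := by
    intro z
    simp only [FormalMultilinearSeries.partialSum, FormalMultilinearSeries.apply_eq_pow_smul_coeff, smul_eq_mul]
    simp [Finset.sum_range_succ]
  have h1 : (fun z : ℂ => g z - (p.coeff 0 + z * p.coeff 1 + z ^ 2 * p.coeff 2)) =O[𝓝 (0 : ℂ)] (fun z : ℂ => ‖z‖ ^ 3) := by
    refine hps.congr' (Eventually.of_forall fun z => ?_) EventuallyEq.rfl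
    simp only [zero_add, hpart]
  -- difference of the two expansions: a quadratic polynomial which is `O(‖z‖³)`
  have hdiff : (fun z : ℂ => (a - p.coeff 0) + z * (b - p.coeff 1) + z ^ 2 * (c - p.coeff 2)) =O[𝓝 (0 : ℂ)] (fun z : ℂ => ‖z‖ ^ 3) := by
    refine (h1.sub h).congr' (Eventually.of_forall fun z => ?_) EventuallyEq.rfl
    simp only
    ring
  obtain ⟨-, -, hc⟩ := quadratic_coeff_eq_zero_of_isBigO hdiff
  have hc' : p.coeff 2 = c := by linear_combination -hc
  -- `∂²g(0) = 2!·p₂(1,1) = 2·coeff₂`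
  have hfs := hpr.factorial_smul 1 2
  rw [iteratedDeriv_eq_iteratedFDeriv, ← hfs, FormalMultilinearSeries.apply_eq_pow_smul_coeff, one_pow, one_smul, hc', Nat.factorial_two,
    nsmul_eq_mul, Nat.cast_ofNat]

/-! ## §2 Part (A)'s remainder is `O(‖z‖³)` -/

variable {F : T3Family} {K : ℕ}

/-- ★ **THE SECOND-ORDER EXPANSION OF `z ↦ actionRe (chartU U₀ (z•Z))` HOLDS UP TO `O(‖z‖³)` AT `0`** (part (A) ✓`actionRe_chartU_smul_eq` + ✓`norm_rem3_chartU_le` summed over the plaquettes).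
[cite: Balaban1985BackgroundPropagators, (3.12) p.392] -/
theorem actionRe_chartU_isBigO (U₀ : GaugeField (F.P K) 0 (Matrix.specialUnitaryGroup (Fin 2) ℂ)) (Z : PBond (F.P K) 0 → Matrix (Fin 2) (Fin 2) ℂ) :
    (fun z : ℂ => actionRe F K (chartU F K U₀ (z • Z))
        - (actionRe F K (bgUnits F K U₀)
          + z * ∑ p : Plaq (F.P K) 0, -(I * (((2 : ℂ)⁻¹ • LinearMap.toContinuousLinearMap (Matrix.traceLinearMap (Fin 2) ℂ ℂ)) : Matrix (Fin 2) (Fin 2) ℂ →ₗ[ℂ] ℂ)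
              (curl (torusT (F.P K) 0) (fun μ x => bgUnits F K U₀ ⟨x, μ⟩) (formComp Z) p.μ p.ν p.src
                * imC (plaqU (torusT (F.P K) 0) (fun μ x => bgUnits F K U₀ ⟨x, μ⟩) p.μ p.ν p.src)))
          + z ^ 2 * ∑ p : Plaq (F.P K) 0, -(2⁻¹ * ((((2 : ℂ)⁻¹ • LinearMap.toContinuousLinearMap (Matrix.traceLinearMap (Fin 2) ℂ ℂ)) : Matrix (Fin 2) (Fin 2) ℂ →ₗ[ℂ] ℂ)
              (curl (torusT (F.P K) 0) (fun μ x => bgUnits F K U₀ ⟨x, μ⟩) (formComp Z) p.μ p.ν p.src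
                * curl (torusT (F.P K) 0) (fun μ x => bgUnits F K U₀ ⟨x, μ⟩) (formComp Z) p.μ p.ν p.src
                * reC (plaqU (torusT (F.P K) 0) (fun μ x => bgUnits F K U₀ ⟨x, μ⟩) p.μ p.ν p.src))
            + (((2 : ℂ)⁻¹ • LinearMap.toContinuousLinearMap (Matrix.traceLinearMap (Fin 2) ℂ ℂ)) : Matrix (Fin 2) (Fin 2) ℂ →ₗ[ℂ] ℂ)
              ((I • commSum (lettersA (torusT (F.P K) 0) (fun μ x => bgUnits F K U₀ ⟨x, μ⟩) (formComp Z) p.μ p.ν p.src))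
                * imC (plaqU (torusT (F.P K) 0) (fun μ x => bgUnits F K U₀ ⟨x, μ⟩) p.μ p.ν p.src))))))
      =O[𝓝 (0 : ℂ)] (fun z : ℂ => ‖z‖ ^ 3) := by
  set ρ : ℝ := ∑ p : Plaq (F.P K) 0, (2⁻¹ * ‖((2 : ℂ)⁻¹ • LinearMap.toContinuousLinearMap (Matrix.traceLinearMap (Fin 2) ℂ ℂ))‖
      * (‖((plaqU (torusT (F.P K) 0) (fun μ x => bgUnits F K U₀ ⟨x, μ⟩) p.μ p.ν p.src : (Matrix (Fin 2) (Fin 2) ℂ)ˣ) : Matrix (Fin 2) (Fin 2) ℂ)‖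
          + ‖(((plaqU (torusT (F.P K) 0) (fun μ x => bgUnits F K U₀ ⟨x, μ⟩) p.μ p.ν p.src)⁻¹ : (Matrix (Fin 2) (Fin 2) ℂ)ˣ) : Matrix (Fin 2) (Fin 2) ℂ)‖)
      * (size (lettersA (torusT (F.P K) 0) (fun μ x => bgUnits F K U₀ ⟨x, μ⟩) (formComp Z) p.μ p.ν p.src) ^ 3 / 6
          * Real.exp (size (lettersA (torusT (F.P K) 0) (fun μ x => bgUnits F K U₀ ⟨x, μ⟩) (formComp Z) p.μ p.ν p.src)))) with hρ
  refine IsBigO.of_bound ρ ?_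
  have hball : ∀ᶠ z : ℂ in 𝓝 0, ‖z‖ ≤ 1 := by
    have : Metric.closedBall (0 : ℂ) 1 ∈ 𝓝 (0 : ℂ) := Metric.closedBall_mem_nhds 0 one_pos
    filter_upwards [this] with z hz
    simpa using hz
  filter_upwards [hball] with z hz
  rw [actionRe_chartU_smul_eq U₀ Z z, add_sub_cancel_left, Real.norm_of_nonneg (by positivity), hρ, Finset.sum_mul]
  refine (norm_sum_le _ _).trans (Finset.sum_le_sum fun p _ => ?_)
  have h := norm_rem3_chartU_le U₀ Z hz p.μ p.ν p.src
  linarith [h]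

/-! ## §3 The row: `hessFormRe U₀ Z Z` in closed lattice letters -/

/-- ★★★ **BRICK L0b's ABSTRACT HESSIAN FORM IS PRINT'S (3.10) AT THE MEMBER** (EXACT background, any exponent field `Z`):
`hessFormRe F K U₀ Z Z = −Σ_{p : Plaq} [τ(C_p·C_p·Re W_p) + τ((i•K_p)·Im W_p)]`, `τ = ½tr`, `C_p = (D¹_{U₀}Z)(p)` (`curl` of `formComp Z` on lit's torus lattice at `U₀`),
`K_p = Σ_{b₁≺b₂}[Z′(b₁), Z′(b₂)]` (`commSum` of the four transported letters), `W_p = U₀(∂p)`, `Re∕Im` = lit's complexified `reC∕imC` — i.e. `D²(A∘chartU U₀)(0)[Z,Z] = −⟨Z, ΔZ⟩_{(3.10)}`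
read at the exponent direction (`⟨A, D*DA⟩ + ⟨A, Δ′A⟩` with `Z = iA`: `τ(C²) + τ(C²(Re W − 1)) = τ(C²·Re W)`).  From ✓`iteratedDeriv_two_actionRe_line` + part (A) + §1.
[cite: Balaban1985BackgroundPropagators, (3.10)–(3.12) p.392, (3.7) p.391] -/
theorem hessFormRe_self_eq (U₀ : GaugeField (F.P K) 0 (Matrix.specialUnitaryGroup (Fin 2) ℂ)) (Z : PBond (F.P K) 0 → Matrix (Fin 2) (Fin 2) ℂ) :
    hessFormRe F K U₀ Z Z
      = 2 * ∑ p : Plaq (F.P K) 0, -(2⁻¹ * ((((2 : ℂ)⁻¹ • LinearMap.toContinuousLinearMap (Matrix.traceLinearMap (Fin 2) ℂ ℂ)) : Matrix (Fin 2) (Fin 2) ℂ →ₗ[ℂ] ℂ)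
              (curl (torusT (F.P K) 0) (fun μ x => bgUnits F K U₀ ⟨x, μ⟩) (formComp Z) p.μ p.ν p.src
                * curl (torusT (F.P K) 0) (fun μ x => bgUnits F K U₀ ⟨x, μ⟩) (formComp Z) p.μ p.ν p.src
                * reC (plaqU (torusT (F.P K) 0) (fun μ x => bgUnits F K U₀ ⟨x, μ⟩) p.μ p.ν p.src))
            + (((2 : ℂ)⁻¹ • LinearMap.toContinuousLinearMap (Matrix.traceLinearMap (Fin 2) ℂ ℂ)) : Matrix (Fin 2) (Fin 2) ℂ →ₗ[ℂ] ℂ)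
              ((I • commSum (lettersA (torusT (F.P K) 0) (fun μ x => bgUnits F K U₀ ⟨x, μ⟩) (formComp Z) p.μ p.ν p.src))
                * imC (plaqU (torusT (F.P K) 0) (fun μ x => bgUnits F K U₀ ⟨x, μ⟩) p.μ p.ν p.src)))) := by
  rw [← iteratedDeriv_two_actionRe_line U₀ Z]
  have hd : Differentiable ℂ (fun z : ℂ => actionRe F K (chartU F K U₀ (z • Z))) := (contDiff_actionRe_line U₀ Z).differentiable (by simp)
  exact iteratedDeriv_two_eq_of_isBigO_cube hd (actionRe_chartU_isBigO U₀ Z)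

/-! ## §4 The junction-ready form: `hessFormRe U₀ Z Z = −hessPair` (lit's `⟨A, ΔA⟩ = ⟨A, D*DA⟩ + ⟨A, Δ′A⟩` at `η = 1`) -/

/-- A sum over the member's plaquettes `Plaq (F.P K) 0` is lit's sum over `posPlaq` (`μ < ν` triples). [folklore] -/
theorem sum_plaq_eq_sum_posPlaq {M : Type*} [AddCommMonoid M] (f : Site (F.P K) 0 → Fin (F.P K).d → Fin (F.P K).d → M) :
    ∑ p : Plaq (F.P K) 0, f p.src p.μ p.ν = ∑ q ∈ B9Eq39Adjoint.posPlaq (Site (F.P K) 0) (Fin (F.P K).d), f q.1 q.2.1 q.2.2 := by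
  classical
  have hinj : Function.Injective (fun p : Plaq (F.P K) 0 => (p.src, p.μ, p.ν)) := by
    rintro ⟨x, μ, ν, h⟩ ⟨x', μ', ν', h'⟩ hpq
    simp only [Prod.mk.injEq] at hpq
    obtain ⟨h1, h2, h3⟩ := hpq
    subst h1; subst h2; subst h3
    rfl
  have himg : (Finset.univ : Finset (Plaq (F.P K) 0)).image (fun p => (p.src, p.μ, p.ν))
      = B9Eq39Adjoint.posPlaq (Site (F.P K) 0) (Fin (F.P K).d) := by
    ext t
    simp only [Finset.mem_image, Finset.mem_univ, true_and, B9Eq39Adjoint.mem_posPlaq]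
    constructor
    · rintro ⟨p, rfl⟩
      exact p.hμν
    · intro ht
      exact ⟨⟨t.1, t.2.1, t.2.2, ht⟩, rfl⟩
  calc ∑ p : Plaq (F.P K) 0, f p.src p.μ p.ν
      = ∑ t ∈ (Finset.univ : Finset (Plaq (F.P K) 0)).image (fun p => (p.src, p.μ, p.ν)), f t.1 t.2.1 t.2.2 := by
        rw [Finset.sum_image fun p _ q _ h => hinj h]
    _ = ∑ q ∈ B9Eq39Adjoint.posPlaq (Site (F.P K) 0) (Fin (F.P K).d), f q.1 q.2.1 q.2.2 := by rw [himg]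

/-- ★★★ **THE JUNCTION-READY FORM: `hessFormRe F K U₀ Z Z = −hessPair T U 1 3 τ (formComp Z)`** — brick L0b's abstract Hessian form on the diagonal IS MINUS lit's
`⟨A, ΔA⟩ = ⟨A, D*D_UA⟩ + ⟨A, Δ′A⟩` of (3.10) (✓`B9Eq39Adjoint.hessPair`, unit spacing `η = 1`, `d = 3` — the weight `η^d = 1`) at the exponent direction `A := formComp Z`
(the sign is `(iA)² = −A²`: `Z = iηA` in print).  Through ✓`B9Eq310DeltaPrimeJunction.hessForm_self_eq_hessPair` this is `B9Eq310DeltaPrime.hessForm`'s diagonal, whose operator is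
✓`B9Eq310HessianOperator.hessOp` — part (C). [cite: Balaban1985BackgroundPropagators, (3.10) p.392, (3.12) p.392] -/
theorem hessFormRe_self_eq_neg_hessPair (U₀ : GaugeField (F.P K) 0 (Matrix.specialUnitaryGroup (Fin 2) ℂ)) (Z : PBond (F.P K) 0 → Matrix (Fin 2) (Fin 2) ℂ) :
    hessFormRe F K U₀ Z Z = -B9Eq39Adjoint.hessPair (torusT (F.P K) 0) (fun μ x => bgUnits F K U₀ ⟨x, μ⟩) 1 3 (((2 : ℂ)⁻¹ • LinearMap.toContinuousLinearMap (Matrix.traceLinearMap (Fin 2) ℂ ℂ)) : Matrix (Fin 2) (Fin 2) ℂ →ₗ[ℂ] ℂ) (formComp Z) := by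
  have hτ : ∀ a b : Matrix (Fin 2) (Fin 2) ℂ, (((2 : ℂ)⁻¹ • LinearMap.toContinuousLinearMap (Matrix.traceLinearMap (Fin 2) ℂ ℂ)) : Matrix (Fin 2) (Fin 2) ℂ →ₗ[ℂ] ℂ) (a * b) = (((2 : ℂ)⁻¹ • LinearMap.toContinuousLinearMap (Matrix.traceLinearMap (Fin 2) ℂ ℂ)) : Matrix (Fin 2) (Fin 2) ℂ →ₗ[ℂ] ℂ) (b * a) :=
    Prop7SectET3ActionQuad.halfTrace_comm
  rw [hessFormRe_self_eq, B9Eq39Adjoint.hessPair, B9Eq39Adjoint.bondPair_divPη_curlη (torusT (F.P K) 0) (fun μ x => bgUnits F K U₀ ⟨x, μ⟩) (((2 : ℂ)⁻¹ • LinearMap.toContinuousLinearMap (Matrix.traceLinearMap (Fin 2) ℂ ℂ)) : Matrix (Fin 2) (Fin 2) ℂ →ₗ[ℂ] ℂ) hτ 1 3 (formComp Z), B9Eq39Adjoint.deltaPrime]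
  simp only [Complex.ofReal_one, one_pow, one_mul, inv_one, one_smul, B9Eq39Adjoint.curlη]
  rw [← Finset.sum_add_distrib, Finset.mul_sum, ← Finset.sum_neg_distrib,
    sum_plaq_eq_sum_posPlaq (fun x μ ν => 2 * -(2⁻¹ * ((((2 : ℂ)⁻¹ • LinearMap.toContinuousLinearMap (Matrix.traceLinearMap (Fin 2) ℂ ℂ)) : Matrix (Fin 2) (Fin 2) ℂ →ₗ[ℂ] ℂ)
        (curl (torusT (F.P K) 0) (fun μ x => bgUnits F K U₀ ⟨x, μ⟩) (formComp Z) μ ν x * curl (torusT (F.P K) 0) (fun μ x => bgUnits F K U₀ ⟨x, μ⟩) (formComp Z) μ ν x * reC (plaqU (torusT (F.P K) 0) (fun μ x => bgUnits F K U₀ ⟨x, μ⟩) μ ν x))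
      + (((2 : ℂ)⁻¹ • LinearMap.toContinuousLinearMap (Matrix.traceLinearMap (Fin 2) ℂ ℂ)) : Matrix (Fin 2) (Fin 2) ℂ →ₗ[ℂ] ℂ) ((I • commSum (lettersA (torusT (F.P K) 0) (fun μ x => bgUnits F K U₀ ⟨x, μ⟩) (formComp Z) μ ν x)) * imC (plaqU (torusT (F.P K) 0) (fun μ x => bgUnits F K U₀ ⟨x, μ⟩) μ ν x)))))]
  refine Finset.sum_congr rfl fun q _ => ?_
  rw [mul_sub, mul_one, map_sub]
  ring

/-! ## §5 Polarization: the BILINEAR Hessian letter in (3.10)'s letters -/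

/-- ★★ **THE BILINEAR FORM `hessFormRe U₀ X′ X` BY POLARIZATION OF (3.10)**: `hessFormRe` is symmetric (✓`hessFormRe_symm`) and bilinear, so
`hessFormRe U₀ X′ X = −½·(h(X′ + X) − h(X′) − h(X))` with `h(Y) := hessPair T U 1 3 τ (formComp Y)` = lit's `⟨·, Δ·⟩` of (3.10) on the diagonal (§4) — print's
`⟨A′, ΔA⟩` for two fields, read at the exponent directions. [cite: Balaban1985BackgroundPropagators, (3.10)–(3.12) p.392] -/
theorem hessFormRe_eq_polar_hessPair (U₀ : GaugeField (F.P K) 0 (Matrix.specialUnitaryGroup (Fin 2) ℂ)) (X' X : PBond (F.P K) 0 → Matrix (Fin 2) (Fin 2) ℂ) :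
    hessFormRe F K U₀ X' X
      = -(2⁻¹ * (B9Eq39Adjoint.hessPair (torusT (F.P K) 0) (fun μ x => bgUnits F K U₀ ⟨x, μ⟩) 1 3 (((2 : ℂ)⁻¹ • LinearMap.toContinuousLinearMap (Matrix.traceLinearMap (Fin 2) ℂ ℂ)) : Matrix (Fin 2) (Fin 2) ℂ →ₗ[ℂ] ℂ) (formComp (X' + X))
          - B9Eq39Adjoint.hessPair (torusT (F.P K) 0) (fun μ x => bgUnits F K U₀ ⟨x, μ⟩) 1 3 (((2 : ℂ)⁻¹ • LinearMap.toContinuousLinearMap (Matrix.traceLinearMap (Fin 2) ℂ ℂ)) : Matrix (Fin 2) (Fin 2) ℂ →ₗ[ℂ] ℂ) (formComp X')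
          - B9Eq39Adjoint.hessPair (torusT (F.P K) 0) (fun μ x => bgUnits F K U₀ ⟨x, μ⟩) 1 3 (((2 : ℂ)⁻¹ • LinearMap.toContinuousLinearMap (Matrix.traceLinearMap (Fin 2) ℂ ℂ)) : Matrix (Fin 2) (Fin 2) ℂ →ₗ[ℂ] ℂ) (formComp X))) := by
  have hsum : hessFormRe F K U₀ (X' + X) (X' + X)
      = hessFormRe F K U₀ X' X' + hessFormRe F K U₀ X' X + (hessFormRe F K U₀ X X' + hessFormRe F K U₀ X X) := by
    have e1 : hessFormRe F K U₀ (X' + X) = hessFormRe F K U₀ X' + hessFormRe F K U₀ X := map_add _ _ _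
    rw [e1, show (hessFormRe F K U₀ X' + hessFormRe F K U₀ X) (X' + X) = hessFormRe F K U₀ X' (X' + X) + hessFormRe F K U₀ X (X' + X) from rfl,
      map_add, map_add]
  rw [hessFormRe_symm U₀ X X'] at hsum
  have h1 := hessFormRe_self_eq_neg_hessPair U₀ (X' + X)
  have h2 := hessFormRe_self_eq_neg_hessPair U₀ X'
  have h3 := hessFormRe_self_eq_neg_hessPair U₀ X
  rw [hsum, h2, h3] at h1
  linear_combination (2 : ℂ)⁻¹ * h1

end Summit.QuantumFields.YangMills.Theorems.Prop7SectET3HessFormExplicit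

end
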